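import Summits.ValiantsHypothesis.ValiantsHypothesis.Theorems.BarrierLeverPartitionMinorsDisjointVariables

/-!
# Route BarrierLever — thin-row Chow witnesses (item 20195), part 1/3: block peeling and a
# nonsingular maximal minor through a prescribed column

Helper file (`--supports stmt-ValiantsHypothesis-20195` `ChowHitsThinRowPartitionMinors`; cell
valiant-natproofs, rung V4, 𝒟-side of door (c); seat val-np-p7 gen 3).  Closes NO item.  Tools for
part 3/3 (`…ChowThinRowsAffineIndependent`: the `s = 1` layer of item 20195 for affinely independent
column families, by an explicit product of affine forms):

* `exists_submatrix_det_ne_zero` — linearly independent rows of an `r × n` matrix over a field have a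
  nonsingular `r × r` column-submatrix; `exists_submatrix_det_ne_zero_through` — by a Cramer exchange
  the chosen columns can be made to contain any prescribed nonzero column.
* `coeff_partitionExpo_mul_block` — peeling one block: if `p` lives in the variables
  `{x_a : a ∈ X} ∪ {y_c : c ∈ Y}` and `q` avoids them, the partition coefficient (items 19717 / 20172 /
  20195: exponent `E u w = Σ_{a∈u} single (castAdd a) 1 + Σ_{c∈w} single (natAdd c) 1`) of `p * q` at
  `(u, w)` is `coeff_{E (u ∩ X) (w ∩ Y)} p · coeff_{E (u ∖ X) (w ∖ Y)} q`
  (from `ChowFactor.coeff_mul_of_disjoint_vars`).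
* `row_eq_of_mem` — rows of size `≤ 1` of an injective layout sharing an element coincide.

WHAT THIS IS NOT: bookkeeping only; nothing on items 20195 / 20172 / 19717, on crux
stmt-ValiantsHypothesis-14610, or on `VP ≠ VNP`.
-/

set_option linter.dupNamespace false

namespace Summit.ValiantsHypothesis.ValiantsHypothesis.Theorems.BarrierLever.ChowThinAffine

open Finset MvPolynomial
open Summit.ValiantsHypothesis.ValiantsHypothesis.Theorems.BarrierLever.ProductStateSums
  (castAdd_ne_natAdd partitionExpo_apply_castAdd partitionExpo_apply_natAdd)
open Summit.ValiantsHypothesis.ValiantsHypothesis.Theorems.BarrierLever.ChowFactor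
  (coeff_mul_of_disjoint_vars)

/-! ## 1. Linear algebra: a nonsingular maximal minor through a prescribed nonzero column -/

section LinearAlgebra

variable {K : Type*} [Field K]

/-- Linearly independent rows of an `r × n` matrix admit `r` columns on which they stay independent:
some `r × r` column-submatrix is nonsingular. -/
theorem exists_submatrix_det_ne_zero {r n : ℕ} (A : Matrix (Fin r) (Fin n) K)
    (hA : LinearIndependent K A.row) :
    ∃ g : Fin r → Fin n, Function.Injective g ∧ (A.submatrix id g).det ≠ 0 := by
  classical
  have hrank : A.rank = r := by
    rw [Matrix.rank_eq_finrank_span_row, finrank_span_eq_card hA, Fintype.card_fin]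
  have hcols : Submodule.span K (Set.range A.col) = ⊤ := by
    apply Submodule.eq_top_of_finrank_eq
    rw [← Matrix.rank_eq_finrank_span_cols, hrank, Module.finrank_fin_fun]
  obtain ⟨b, hbsub, hbspan, hbli⟩ := exists_linearIndependent K (Set.range A.col)
  have hbfin : b.Finite := (Set.finite_range A.col).subset hbsub
  letI : Fintype b := hbfin.fintype
  have hcard : Fintype.card b = r := by
    have h1 := finrank_span_eq_card hbli
    rw [Subtype.range_coe_subtype, Set.setOf_mem_eq, hbspan, hcols, finrank_top,
      Module.finrank_fin_fun] at h1
    exact h1.symm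
  let e : Fin r ≃ b := (Fintype.equivFinOfCardEq hcard).symm
  have hex : ∀ x : b, ∃ j : Fin n, A.col j = (x : Fin r → K) := fun x => hbsub x.2
  choose g₀ hg₀ using hex
  refine ⟨fun i => g₀ (e i), ?_, ?_⟩
  · intro i i' hii'
    have hii : g₀ (e i) = g₀ (e i') := hii'
    have : ((e i : b) : Fin r → K) = (e i' : b) := by rw [← hg₀ (e i), ← hg₀ (e i'), hii]
    exact e.injective (Subtype.ext this)
  · set B : Matrix (Fin r) (Fin r) K := A.submatrix id (fun i => g₀ (e i)) with hB
    have hcolB : B.col = (Subtype.val : b → Fin r → K) ∘ e := by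
      funext j
      rw [Function.comp_apply, ← hg₀ (e j)]
      rfl
    have hliB : LinearIndependent K B.col := by
      rw [hcolB]
      exact hbli.comp e e.injective
    have hunit : IsUnit B := Matrix.linearIndependent_cols_iff_isUnit.mp hliB
    exact ((Matrix.isUnit_iff_isUnit_det B).mp hunit).ne_zero

/-- Cramer exchange: a nonsingular column-submatrix can be rearranged to pass through any prescribed
nonzero column. -/
theorem exists_submatrix_det_ne_zero_through {r n : ℕ} (A : Matrix (Fin r) (Fin n) K)
    (g : Fin r → Fin n) (hg : Function.Injective g) (hdet : (A.submatrix id g).det ≠ 0)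
    (c₀ : Fin n) (hc₀ : (fun i => A i c₀) ≠ 0) :
    ∃ g' : Fin r → Fin n, Function.Injective g' ∧ (A.submatrix id g').det ≠ 0 ∧ c₀ ∈ Set.range g' := by
  classical
  by_cases hmem : c₀ ∈ Set.range g
  · exact ⟨g, hg, hdet, hmem⟩
  set B : Matrix (Fin r) (Fin r) K := A.submatrix id g with hB
  have hcr : B.cramer (fun i => A i c₀) ≠ 0 := by
    intro h0
    have hmv := Matrix.mulVec_cramer B (fun i => A i c₀)
    rw [h0, Matrix.mulVec_zero] at hmv
    have : (fun i => A i c₀) = 0 := by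
      rcases smul_eq_zero.mp hmv.symm with hd | hv
      · exact absurd hd hdet
      · exact hv
    exact hc₀ this
  obtain ⟨i₁, hi₁⟩ : ∃ i₁, B.cramer (fun i => A i c₀) i₁ ≠ 0 := by
    by_contra hall
    push Not at hall
    exact hcr (funext hall)
  rw [Matrix.cramer_apply] at hi₁
  refine ⟨Function.update g i₁ c₀, ?_, ?_, ⟨i₁, by simp⟩⟩
  · intro i i' hii'
    by_cases hi : i = i₁
    · by_cases hi' : i' = i₁
      · rw [hi, hi']
      · rw [hi, Function.update_self, Function.update_of_ne hi'] at hii'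
        exact absurd ⟨i', hii'.symm⟩ hmem
    · by_cases hi' : i' = i₁
      · rw [hi', Function.update_self, Function.update_of_ne hi] at hii'
        exact absurd ⟨i, hii'⟩ hmem
      · rw [Function.update_of_ne hi, Function.update_of_ne hi'] at hii'
        exact hg hii'
  · have hmat : A.submatrix id (Function.update g i₁ c₀) = B.updateCol i₁ (fun i => A i c₀) := by
      ext i j
      rw [Matrix.submatrix_apply, Matrix.updateCol_apply, hB, Matrix.submatrix_apply]
      by_cases hj : j = i₁
      · rw [if_pos hj, hj, Function.update_self, id]
      · rw [if_neg hj, Function.update_of_ne hj, id]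
    rw [hmat]
    exact hi₁

end LinearAlgebra

/-! ## 2. Coefficients of a product of polynomials in disjoint blocks of variables -/

section Blocks

variable {h : ℕ}

/-- A polynomial whose variables lie in `S` has every monomial supported in `S`. -/
theorem monomial_apply_eq_zero_of_vars_subset {R : Type*} [CommSemiring R] {σ : Type*}
    [DecidableEq σ] {p : MvPolynomial σ R} {S : Finset σ} (hp : p.vars ⊆ S) :
    ∀ m ∈ p.support, ∀ v, v ∉ S → m v = 0 := by
  intro m hm v hv
  by_contra hne
  have : v ∈ p.vars := (mem_vars_iff_mem_support v).mpr ⟨m, hm, Finsupp.mem_support_iff.mpr hne⟩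
  exact hv (hp this)

/-- The part of the partition exponent `E u w` inside a block of variables
`{x_a : a ∈ X} ∪ {y_c : c ∈ Y}`. -/
theorem partitionExpo_filter_block (u w X Y : Finset (Fin h)) :
    Finsupp.filter (fun v => v ∈ X.image (Fin.castAdd h) ∪ Y.image (Fin.natAdd h))
        (∑ a' ∈ u, Finsupp.single (Fin.castAdd h a') 1 +
          ∑ c' ∈ w, Finsupp.single (Fin.natAdd h c') 1 : Fin (h + h) →₀ ℕ) =
      ∑ a' ∈ u.filter (fun a' => a' ∈ X), Finsupp.single (Fin.castAdd h a') 1 +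
        ∑ c' ∈ w.filter (fun c' => c' ∈ Y), Finsupp.single (Fin.natAdd h c') 1 := by
  classical
  ext v
  rw [Finsupp.filter_apply]
  induction v using Fin.addCases with
  | left b =>
    rw [partitionExpo_apply_castAdd, partitionExpo_apply_castAdd]
    have hiff : (Fin.castAdd h b ∈ X.image (Fin.castAdd h) ∪ Y.image (Fin.natAdd h)) ↔ b ∈ X := by
      rw [Finset.mem_union, Finset.mem_image, Finset.mem_image]
      constructor
      · rintro (⟨a, ha, e⟩ | ⟨c, _, e⟩)
        · rwa [← Fin.castAdd_injective _ _ e]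
        · exact absurd e.symm (castAdd_ne_natAdd b c)
      · exact fun hb => Or.inl ⟨b, hb, rfl⟩
    by_cases hb : b ∈ X
    · rw [if_pos (hiff.mpr hb)]
      simp [Finset.mem_filter, hb]
    · rw [if_neg (fun h' => hb (hiff.mp h'))]
      simp [Finset.mem_filter, hb]
  | right d =>
    rw [partitionExpo_apply_natAdd, partitionExpo_apply_natAdd]
    have hiff : (Fin.natAdd h d ∈ X.image (Fin.castAdd h) ∪ Y.image (Fin.natAdd h)) ↔ d ∈ Y := by
      rw [Finset.mem_union, Finset.mem_image, Finset.mem_image]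
      constructor
      · rintro (⟨a, _, e⟩ | ⟨c, hc, e⟩)
        · exact absurd e (castAdd_ne_natAdd a d)
        · rwa [← Fin.natAdd_injective _ _ e]
      · exact fun hd => Or.inr ⟨d, hd, rfl⟩
    by_cases hd : d ∈ Y
    · rw [if_pos (hiff.mpr hd)]
      simp [Finset.mem_filter, hd]
    · rw [if_neg (fun h' => hd (hiff.mp h'))]
      simp [Finset.mem_filter, hd]

/-- The complementary part of the partition exponent. -/
theorem partitionExpo_filter_not_block (u w X Y : Finset (Fin h)) :
    Finsupp.filter (fun v => ¬ (v ∈ X.image (Fin.castAdd h) ∪ Y.image (Fin.natAdd h)))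
        (∑ a' ∈ u, Finsupp.single (Fin.castAdd h a') 1 +
          ∑ c' ∈ w, Finsupp.single (Fin.natAdd h c') 1 : Fin (h + h) →₀ ℕ) =
      ∑ a' ∈ u.filter (fun a' => a' ∉ X), Finsupp.single (Fin.castAdd h a') 1 +
        ∑ c' ∈ w.filter (fun c' => c' ∉ Y), Finsupp.single (Fin.natAdd h c') 1 := by
  classical
  ext v
  rw [Finsupp.filter_apply]
  induction v using Fin.addCases with
  | left b =>
    rw [partitionExpo_apply_castAdd, partitionExpo_apply_castAdd]
    have hiff : (Fin.castAdd h b ∈ X.image (Fin.castAdd h) ∪ Y.image (Fin.natAdd h)) ↔ b ∈ X := by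
      rw [Finset.mem_union, Finset.mem_image, Finset.mem_image]
      constructor
      · rintro (⟨a, ha, e⟩ | ⟨c, _, e⟩)
        · rwa [← Fin.castAdd_injective _ _ e]
        · exact absurd e.symm (castAdd_ne_natAdd b c)
      · exact fun hb => Or.inl ⟨b, hb, rfl⟩
    by_cases hb : b ∈ X
    · rw [if_neg (fun h' => h' (hiff.mpr hb))]
      simp [Finset.mem_filter, hb]
    · rw [if_pos (fun h' => hb (hiff.mp h'))]
      simp [Finset.mem_filter, hb]
  | right d =>
    rw [partitionExpo_apply_natAdd, partitionExpo_apply_natAdd]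
    have hiff : (Fin.natAdd h d ∈ X.image (Fin.castAdd h) ∪ Y.image (Fin.natAdd h)) ↔ d ∈ Y := by
      rw [Finset.mem_union, Finset.mem_image, Finset.mem_image]
      constructor
      · rintro (⟨a, _, e⟩ | ⟨c, hc, e⟩)
        · exact absurd e (castAdd_ne_natAdd a d)
        · rwa [← Fin.natAdd_injective _ _ e]
      · exact fun hd => Or.inr ⟨d, hd, rfl⟩
    by_cases hd : d ∈ Y
    · rw [if_neg (fun h' => h' (hiff.mpr hd))]
      simp [Finset.mem_filter, hd]
    · rw [if_pos (fun h' => hd (hiff.mp h'))]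
      simp [Finset.mem_filter, hd]

/-- **Peeling one block.**  If `p` uses only the variables `{x_a : a ∈ X} ∪ {y_c : c ∈ Y}` and `q` uses
none of them, the partition coefficient of `p * q` at `(u, w)` is the block coefficient of `p` at
`(u ∩ X, w ∩ Y)` times the coefficient of `q` at `(u \ X, w \ Y)`. -/
theorem coeff_partitionExpo_mul_block {R : Type*} [CommSemiring R]
    (p q : MvPolynomial (Fin (h + h)) R) (X Y : Finset (Fin h))
    (hp : p.vars ⊆ X.image (Fin.castAdd h) ∪ Y.image (Fin.natAdd h))
    (hq : Disjoint q.vars (X.image (Fin.castAdd h) ∪ Y.image (Fin.natAdd h)))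
    (u w : Finset (Fin h)) :
    coeff (∑ a' ∈ u, Finsupp.single (Fin.castAdd h a') 1 + ∑ c' ∈ w, Finsupp.single (Fin.natAdd h c') 1)
        (p * q) =
      coeff (∑ a' ∈ u.filter (fun a' => a' ∈ X), Finsupp.single (Fin.castAdd h a') 1 +
          ∑ c' ∈ w.filter (fun c' => c' ∈ Y), Finsupp.single (Fin.natAdd h c') 1) p *
        coeff (∑ a' ∈ u.filter (fun a' => a' ∉ X), Finsupp.single (Fin.castAdd h a') 1 +
          ∑ c' ∈ w.filter (fun c' => c' ∉ Y), Finsupp.single (Fin.natAdd h c') 1) q := by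
  classical
  have hp' := monomial_apply_eq_zero_of_vars_subset hp
  have hq' : ∀ m ∈ q.support, ∀ v, v ∈ X.image (Fin.castAdd h) ∪ Y.image (Fin.natAdd h) →
      m v = 0 := by
    intro m hm v hv
    by_contra hne
    have hvq : v ∈ q.vars :=
      (mem_vars_iff_mem_support v).mpr ⟨m, hm, Finsupp.mem_support_iff.mpr hne⟩
    exact Finset.disjoint_left.mp hq hvq hv
  rw [coeff_mul_of_disjoint_vars (fun v => v ∈ X.image (Fin.castAdd h) ∪ Y.image (Fin.natAdd h))
    p q hp' hq', partitionExpo_filter_block, partitionExpo_filter_not_block]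

end Blocks

section Rows

/-- Two rows of size `≤ 1` of an injective layout that share an element are the same row. -/
theorem row_eq_of_mem {h r : ℕ} {u : Fin r → Finset (Fin h)} (hu : Function.Injective u)
    (hcard : ∀ i, (u i).card ≤ 1) {i i' : Fin r} {x : Fin h} (hx : x ∈ u i) (hx' : x ∈ u i') :
    i = i' := by
  apply hu
  have h1 : u i = {x} := Finset.eq_singleton_iff_unique_mem.mpr
    ⟨hx, fun y hy => Finset.card_le_one.mp (hcard i) y hy x hx⟩
  have h2 : u i' = {x} := Finset.eq_singleton_iff_unique_mem.mpr
    ⟨hx', fun y hy => Finset.card_le_one.mp (hcard i') y hy x hx'⟩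
  rw [h1, h2]

end Rows

end Summit.ValiantsHypothesis.ValiantsHypothesis.Theorems.BarrierLever.ChowThinAffine
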